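import Mathlib
import HarnessLib
import Summits.CriticalPhenomena.PercolationContinuityZ3.Theses.PercLowPointHalfSpace
import Summits.CriticalPhenomena.PercolationContinuityZ3.Theorems.PercLowPointHalfSpaceHalfSpaceAxisDecay
import Summits.CriticalPhenomena.PercolationContinuityZ3.Theorems.PercLowPointHalfSpaceAssemblyWallExit
import Summits.CriticalPhenomena.PercolationContinuityZ3.Theorems.PercLowPointHalfSpaceLowPointBookkeepingStubDilutionToolkit
import Literature.Probability.Percolation.HalfSpaceFloorDilution
import Literature.Probability.Percolation.Crossings
import Literature.Probability.Percolation.CriticalContinuityProofs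
import Literature.Probability.LatticeModels.ProdBernoulliIndependence

/-!
# Stub `stub_floorCoupling` of crux `LowPointBookkeeping` (stmt-CriticalPhenomena-14713), part 2: clusters

Helper file 2/4; lands `--supports stmt-CriticalPhenomena-14713` with the registered def-free sub-goal
`stub_floorCouplingCluster` (a.s. finiteness of all half-space clusters under `P^{ℍ}_{p_c,1}`).

Deterministic facts about `{x ↔ y in S}` (restriction to the cluster of a dominating
configuration, decomposition of a pivotal floor edge into two disjoint clusters, removal of all
floor edges confines `ℍ`-paths between points of `ℍ₊` to `ℍ₊`), and the almost sure finiteness of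
every half-space cluster under the floor-diluted critical measure at `s = 1`
(Barsky–Grimmett–Newman + Harris).
-/

noncomputable section

namespace Summit.CriticalPhenomena.PercolationContinuityZ3.Theorems.FloorRusso.Coupling

open MeasureTheory Set
open Literature.Probability.Percolation Literature.Probability.LatticeModels
open scoped ENNReal

/-! ### Deterministic cluster lemmas (general vertex type) -/

section General

variable {V : Type*}

/-- The cluster of `a` inside `S` in the configuration `ω`. -/
abbrev clusterIn (S : Set V) (ω : BondConfig V) (a : V) : Set V := {v | ω ∈ openConnIn S a v}

/-- `{x ↔ y in S}` is increasing in the configuration. -/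
theorem conn_mono_cfg {S : Set V} {x y : V} {ω ω' : BondConfig V} (h : ω ⊆ ω')
    (hω : ω ∈ openConnIn S x y) : ω' ∈ openConnIn S x y :=
  isUpperSet_openConnIn S x y h hω

/-- An `S`-connection of `ω` is an `(S ∩ C)`-connection, `C` the `S`-cluster of `a` in any
configuration `ω̄ ⊇ ω`. -/
theorem conn_inter_cluster {S : Set V} {ω ω' : BondConfig V} (hsub : ω ⊆ ω') {a b : V}
    (hab : ω ∈ openConnIn S a b) : ω ∈ openConnIn (S ∩ clusterIn S ω' a) a b := by
  have ha : a ∈ S := hab.1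
  have hcl : openClusterIn (withinGraph ⊤ S) ω a ⊆ S ∩ clusterIn S ω' a := by
    intro y hy
    have hy' : ω ∈ openConnIn S a y := (LowPoint.conn_iff_mem_cluster ha).2 hy
    have hy'' := hy'
    obtain ⟨_, hyS, _⟩ := hy''
    exact ⟨hyS, conn_mono_cfg hsub hy'⟩
  have hb : b ∈ openClusterIn (withinGraph ⊤ S) ω a := (LowPoint.conn_iff_mem_cluster ha).1 hab
  have hb' := LowPoint.cluster_subset_of_subset hcl hb
  exact (LowPoint.conn_iff_mem_cluster
    (show a ∈ S ∩ clusterIn S ω' a from ⟨ha, LowPoint.conn_refl ω' ha⟩)).2 hb'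

/-- **Restriction to the cluster.** For `ω ⊆ ω̄`, whether `a ↔ b in S` holds in `ω` depends only
on the trace of `ω` on the pairs of vertices of the `S`-cluster of `a` in `ω̄`. -/
theorem conn_iff_inter_sym2_cluster {S : Set V} {ω ω' : BondConfig V} (hsub : ω ⊆ ω') (a b : V) :
    ω ∈ openConnIn S a b ↔ ω ∩ (clusterIn S ω' a).sym2 ∈ openConnIn S a b := by
  constructor
  · intro hab
    have h1 := conn_inter_cluster hsub hab
    have hdet := DCT16.determinedBy_openConnIn (S ∩ clusterIn S ω' a) a b
      (K := (clusterIn S ω' a).sym2) (fun z hz => Set.mem_sym2_iff_subset.2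
        ((Set.mem_sym2_iff_subset.1 hz).trans inter_subset_right))
    have h2 : ω ∩ (clusterIn S ω' a).sym2 ∈ openConnIn (S ∩ clusterIn S ω' a) a b :=
      ((determinedBy_iff _ _).1 hdet ω (ω ∩ (clusterIn S ω' a).sym2)
        (by rw [inter_assoc, inter_self])).1 h1
    exact LowPoint.conn_mono inter_subset_left h2
  · exact fun h => conn_mono_cfg inter_subset_left h

/-- Two sub-configurations of `ω̄` with the same trace on the pairs of the cluster of `a` have the
same `S`-connections from `a`. -/
theorem conn_congr_of_inter_eq {S : Set V} {ω₁ ω₂ ω' : BondConfig V} (h₁ : ω₁ ⊆ ω') (h₂ : ω₂ ⊆ ω')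
    {a : V} (heq : ω₁ ∩ (clusterIn S ω' a).sym2 = ω₂ ∩ (clusterIn S ω' a).sym2) (b : V) :
    ω₁ ∈ openConnIn S a b ↔ ω₂ ∈ openConnIn S a b := by
  rw [conn_iff_inter_sym2_cluster h₁, heq, ← conn_iff_inter_sym2_cluster h₂]

/-- **Decomposition of a pivotal edge.** If `a ↔ b in S` fails in `ω` but holds after opening the
pair `s(x, x')` (`x ≠ x'`), then in `ω` one endpoint is `S`-joined to `a`, the other to `b`, and the
two endpoints are not `S`-joined. -/
theorem pivot_decomp {S : Set V} {ω : BondConfig V} {a b x x' : V} (hxx' : x ≠ x')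
    (hno : ω ∉ openConnIn S a b) (hyes : insert s(x, x') ω ∈ openConnIn S a b) :
    (ω ∈ openConnIn S x a ∧ ω ∈ openConnIn S x' b ∧ ω ∉ openConnIn S x x') ∨
      (ω ∈ openConnIn S x' a ∧ ω ∈ openConnIn S x b ∧ ω ∉ openConnIn S x' x) := by
  -- the crossing edge of a walk leaving the cluster `D` of its start is the inserted pair
  have key : ∀ {u w : V}, insert s(x, x') ω ∈ openConnIn S u w → ω ∉ openConnIn S u w →
      ∃ c c', ω ∈ openConnIn S u c ∧ ω ∉ openConnIn S u c' ∧ c' ∈ S ∧ s(c, c') = s(x, x') := by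
    intro u w huw hno'
    obtain ⟨hu, hw, hr⟩ := huw
    have hr' := reachable_within_top_of_reachable_induce S hr
    obtain ⟨p⟩ := hr'
    obtain ⟨c, c', hc, hc', hadj⟩ := LowPoint.exists_adj_mem_not_mem (D := clusterIn S ω u) p
      (LowPoint.conn_refl ω hu) hno'
    obtain ⟨⟨hmem, hne⟩, -, hcS, hc'S⟩ :=
      show (s(c, c') ∈ insert s(x, x') ω ∧ c ≠ c') ∧ ((⊤ : SimpleGraph V).Adj c c' ∧ c ∈ S ∧ c' ∈ S)
        from ⟨(openGraph_adj _ _ _).1 hadj.1, hadj.2⟩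
    rcases mem_insert_iff.1 hmem with heq | hω
    · exact ⟨c, c', hc, hc', hc'S, heq⟩
    · exact absurd (LowPoint.conn_step hc hω hne hc'S) hc'
  obtain ⟨c, c', hc, hc', hc'S, hcc'⟩ := key hyes hno
  obtain ⟨d, d', hd, hd', hd'S, hdd'⟩ := key (LowPoint.conn_symm hyes) (fun h => hno (LowPoint.conn_symm h))
  -- `c, d` are on the `a`-side resp. `b`-side; they are distinct endpoints of the pair
  have hcd : c ≠ d := by
    rintro rfl
    exact hno (LowPoint.conn_trans hc (LowPoint.conn_symm hd))
  rcases Sym2.eq_iff.1 hcc' with ⟨rfl, rfl⟩ | ⟨rfl, rfl⟩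
  · -- c = x, c' = x'
    rcases Sym2.eq_iff.1 hdd' with ⟨rfl, rfl⟩ | ⟨rfl, rfl⟩
    · exact absurd rfl hcd
    · exact Or.inl ⟨LowPoint.conn_symm hc, LowPoint.conn_symm hd, fun h => hc' (LowPoint.conn_trans hc h)⟩
  · -- c = x', c' = x
    rcases Sym2.eq_iff.1 hdd' with ⟨rfl, rfl⟩ | ⟨rfl, rfl⟩
    · exact Or.inr ⟨LowPoint.conn_symm hc, LowPoint.conn_symm hd, fun h => hc' (LowPoint.conn_trans hc h)⟩
    · exact absurd rfl hcd

end General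

/-! ### Almost sure finiteness of half-space clusters under `P^{ℍ}_{p_c,1}` -/

section Finite

/-- Local shorthand: the floor-diluted critical half-space measure. -/
abbrev μH (s : unitInterval) : Measure (BondConfig (Site 3)) :=
  floorDilutedPercolation 3 (criticalProbI 3) s

/-- The event that the `ℍ`-cluster of `a` is infinite. -/
abbrev InfCl (a : Site 3) : Set (BondConfig (Site 3)) :=
  {ω | (clusterIn {x : Site 3 | 0 ≤ x 0} ω a).Infinite}

/-- `isUpperSet_infCl` (helper, see the module docstring). -/
theorem isUpperSet_infCl (a : Site 3) : IsUpperSet (InfCl a) :=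
  fun _ _ h hω => hω.mono fun _ hv => conn_mono_cfg h hv

/-- `{C_ℍ(a) finite} = ⋃_N ⋂_{v ∉ B_N} {a ↮_ℍ v}` is measurable. -/
theorem measurableSet_infCl (a : Site 3) : MeasurableSet (InfCl a) := by
  have hfin : (InfCl a)ᶜ = ⋃ N : ℕ, ⋂ v ∈ ((↑(box 3 N) : Set (Site 3))ᶜ),
      (openConnIn {x : Site 3 | 0 ≤ x 0} a v)ᶜ := by
    ext ω
    simp only [mem_compl_iff, mem_setOf_eq, Set.not_infinite, mem_iUnion, mem_iInter]
    constructor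
    · intro hfin
      obtain ⟨N, hN⟩ : ∃ N : ℕ, clusterIn {x : Site 3 | 0 ≤ x 0} ω a ⊆ ↑(box 3 N) := by
        obtain ⟨T, hT⟩ := hfin.exists_finset_coe
        -- a finite set of sites lies in some box
        obtain ⟨N, hN⟩ : ∃ N : ℕ, ∀ v ∈ T, v ∈ box 3 N := by
          refine ⟨T.sup fun v => Finset.univ.sup fun i => (v i).natAbs, fun v hv => ?_⟩
          rw [mem_box]
          intro i
          have h1 : (v i).natAbs ≤ Finset.univ.sup fun j => (v j).natAbs :=
            Finset.le_sup (f := fun j => (v j).natAbs) (Finset.mem_univ i)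
          have h2 : (Finset.univ.sup fun j => (v j).natAbs) ≤
              T.sup fun v => Finset.univ.sup fun i => (v i).natAbs :=
            Finset.le_sup (f := fun v => Finset.univ.sup fun i => (v i).natAbs) hv
          have := h1.trans h2
          omega
        exact ⟨N, fun v hv => Finset.mem_coe.2 (hN v (by rw [← hT] at hv; exact hv))⟩
      exact ⟨N, fun v hv hconn => hv (hN hconn)⟩
    · rintro ⟨N, hN⟩
      exact (box 3 N).finite_toSet.subset fun v hv => by_contra fun h => hN v h hv
  have : MeasurableSet (InfCl a)ᶜ := by
    rw [hfin]
    exact MeasurableSet.iUnion fun N => MeasurableSet.biInter (Set.to_countable _) fun v _ =>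
      (measurableSet_openConnIn_of_countable _ _ _).compl
  exact MeasurableSet.compl_iff.1 this

/-- `{C_ℍ(a) infinite}` is determined by the pairs of points of `ℍ`. -/
theorem determinedBy_infCl (a : Site 3) : DeterminedBy (InfCl a) {x : Site 3 | 0 ≤ x 0}.sym2 := by
  rw [determinedBy_iff]
  intro ω ω' h
  have hset : clusterIn {x : Site 3 | 0 ≤ x 0} ω a = clusterIn {x : Site 3 | 0 ≤ x 0} ω' a := by
    ext v
    exact (determinedBy_iff _ _).1 (DCT16.determinedBy_openConnIn {x : Site 3 | 0 ≤ x 0} a v subset_rfl)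
      ω ω' h
  simp only [mem_setOf_eq, hset]

/-- **The `ℍ`-cluster of the origin is a.s. finite under `P^{ℍ}_{p_c,1}`** (BGN, transferred from
`bondPercolation` through the common trace on the half-space pairs). -/
theorem measure_infCl_zero : μH 1 (InfCl 0) = 0 := by
  have h1 : μH 1 (InfCl 0) = bondPercolation (zdGraph 3) (criticalProbI 3) (InfCl 0) :=
    floorDilutedPercolation_one_apply_eq (criticalProbI 3) (determinedBy_infCl 0) (measurableSet_infCl 0)
  rw [h1, measure_eq_zero_iff_ae_notMem]
  filter_upwards [ae_finite_openClusterIn_halfSpace_criticalProbI] with ω hω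
  simp only [Set.not_infinite]
  convert hω using 1
  ext v
  exact LowPoint.conn_iff_mem_cluster (show (0 : Site 3) ∈ {x : Site 3 | 0 ≤ x 0} from Set.mem_setOf.mpr le_rfl)

/-- The same for every floor point (horizontal translation invariance). -/
theorem measure_infCl_floor (z : Site 3) (hz : z 0 = 0) : μH 1 (InfCl z) = 0 := by
  have hT : (BondConfig.relabel (sym2Equiv (Site.shift z))) ⁻¹' InfCl z = InfCl 0 := by
    ext ω
    simp only [mem_preimage, mem_setOf_eq]
    have hpre := LowPoint.preimage_add_level_of_floor z hz 0
    have key : ∀ v : Site 3, BondConfig.relabel (sym2Equiv (Site.shift z)) ω ∈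
        openConnIn {x : Site 3 | 0 ≤ x 0} z (v + z) ↔ ω ∈ openConnIn {x : Site 3 | 0 ≤ x 0} 0 v := by
      intro v
      have h := LowPoint.shift_mem_openConnIn_iff z {x : Site 3 | (0 : ℤ) ≤ x 0} ω 0 v
      rw [zero_add, hpre] at h
      exact h
    have himage : clusterIn {x : Site 3 | 0 ≤ x 0} (BondConfig.relabel (sym2Equiv (Site.shift z)) ω) z =
        (fun v => v + z) '' clusterIn {x : Site 3 | 0 ≤ x 0} ω 0 := by
      ext w
      simp only [mem_setOf_eq, mem_image]
      constructor
      · intro hw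
        refine ⟨w - z, ?_, sub_add_cancel w z⟩
        have := key (w - z); rw [sub_add_cancel] at this; exact this.1 hw
      · rintro ⟨v, hv, rfl⟩; exact (key v).2 hv
    rw [himage]
    exact Set.infinite_image_iff (add_left_injective z).injOn
  have hmap := DilutionToolkit.map_shift 1 z hz
  calc μH 1 (InfCl z)
      = (floorDilutedPercolation 3 (criticalProbI 3) 1).map
          (BondConfig.relabel (sym2Equiv (Site.shift z))) (InfCl z) := by rw [hmap]
    _ = μH 1 (InfCl 0) := by
        rw [Measure.map_apply (MeasurableEquiv.measurable _) (measurableSet_infCl z), hT]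
    _ = 0 := measure_infCl_zero

/-- **Every `ℍ`-cluster is a.s. finite under `P^{ℍ}_{p_c,1}`**: join `a` to the floor point below
it by the vertical segment (positive probability) and use Harris' inequality. -/
theorem measure_infCl (a : Site 3) (ha : 0 ≤ a 0) : μH 1 (InfCl a) = 0 := by
  classical
  -- the floor point below `a` and the vertical segment
  obtain ⟨h, hh⟩ : ∃ h : ℕ, a 0 = h := ⟨(a 0).toNat, (Int.toNat_of_nonneg ha).symm⟩
  set z : Site 3 := a - Pi.single 0 (h : ℤ) with hz
  have hz0 : z 0 = 0 := by simp [hz, hh]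
  set P : Finset (Sym2 (Site 3)) := (Finset.range h).image fun k : ℕ =>
    s(z + Pi.single 0 (k : ℤ), z + Pi.single 0 ((k : ℤ) + 1)) with hP
  -- the segment event
  set V : Set (BondConfig (Site 3)) := {ω | (↑P : Set (Sym2 (Site 3))) ⊆ ω} with hV
  have hVup : IsUpperSet V := fun _ _ hle hω => hω.trans hle
  have hVm : MeasurableSet V := by
    have : V = ⋂ e ∈ P, {ω | e ∈ ω} := by ext ω; simp [hV, Set.subset_def]
    rw [this]
    exact MeasurableSet.biInter (Set.to_countable _) fun e _ => measurableSet_mem e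
  -- its probability is positive: every edge of the segment has weight `p_c > 0`
  have hpc : 0 < (criticalProbI 3 : ℝ) := by
    rw [coe_criticalProbI]; exact criticalProb_zd_pos 3 (by norm_num)
  have hparam : ∀ e ∈ P, (floorDilutedParam 3 (criticalProbI 3) 1 e : ℝ) = criticalProbI 3 := by
    intro e he
    obtain ⟨k, -, rfl⟩ := Finset.mem_image.1 he
    have hE : s(z + Pi.single 0 (k : ℤ), z + Pi.single 0 ((k : ℤ) + 1)) ∈ (zdGraph 3).edgeSet := by
      rw [SimpleGraph.mem_edgeSet, zdGraph_adj_iff]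
      exact ⟨0, Or.inl (by rw [add_assoc, ← Pi.single_add])⟩
    have hH : s(z + Pi.single 0 (k : ℤ), z + Pi.single 0 ((k : ℤ) + 1)) ∈ halfSpaceEdgeSet 3 := by
      refine ⟨hE, fun w hw => ?_⟩
      rcases Sym2.mem_iff.1 hw with rfl | rfl
      · simp [hz0]
      · simp [hz0]; omega
    have hnf : s(z + Pi.single 0 (k : ℤ), z + Pi.single 0 ((k : ℤ) + 1)) ∉ floorEdgeSet 3 := by
      rintro ⟨-, hf⟩
      have := hf _ (Sym2.mem_mk_right _ _)
      simp [hz0] at this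
      omega
    rw [floorDilutedParam_one_of_mem_halfSpaceEdgeSet _ hH]
  have hVpos : 0 < (μH 1).real V := by
    rw [show μH 1 = prodBernoulli (floorDilutedParam 3 (criticalProbI 3) 1) from rfl,
      prodBernoulli_real_subset]
    exact Finset.prod_pos fun e he => by rw [hparam e he]; exact hpc
  -- on `V`, `z ↔_ℍ a`
  have hconn : ∀ ω ∈ V, ω ∈ openConnIn {x : Site 3 | 0 ≤ x 0} z a := by
    intro ω hω
    have hstep : ∀ k : ℕ, k ≤ h → ω ∈ openConnIn {x : Site 3 | 0 ≤ x 0} z (z + Pi.single 0 (k : ℤ)) := by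
      intro k hk
      induction k with
      | zero => simpa using LowPoint.conn_refl ω (show (0 : ℤ) ≤ z 0 by omega)
      | succ k ih =>
        have hk' : k < h := Nat.lt_of_succ_le hk
        have hmem : s(z + Pi.single 0 (k : ℤ), z + Pi.single 0 ((k : ℤ) + 1)) ∈ ω :=
          hω (Finset.mem_coe.2 (Finset.mem_image.2 ⟨k, Finset.mem_range.2 hk', rfl⟩))
        have hne : z + Pi.single 0 (k : ℤ) ≠ z + Pi.single 0 ((k : ℤ) + 1) := by
          intro heq; have := congrFun heq 0; simp at this
        have hH0 : (0 : ℤ) ≤ (z + Pi.single 0 ((k : ℤ) + 1) : Site 3) 0 := by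
          simp only [Pi.add_apply, Pi.single_eq_same, hz0]; omega
        have := LowPoint.conn_step (ih hk'.le) hmem hne hH0
        simpa [Nat.cast_succ] using this
    have := hstep h le_rfl
    have haz : z + Pi.single 0 (h : ℤ) = a := by simp [hz]
    rwa [haz] at this
  -- Harris: P(V) P(Inf a) ≤ P(V ∩ Inf a) ≤ P(Inf z) = 0
  have hH := prodBernoulli_harris (floorDilutedParam 3 (criticalProbI 3) 1) hVup (isUpperSet_infCl a)
    hVm (measurableSet_infCl a)
  have hsub : V ∩ InfCl a ⊆ InfCl z := by
    rintro ω ⟨hωV, hωI⟩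
    refine Set.Infinite.mono (fun v (hv : ω ∈ openConnIn _ a v) => ?_) hωI
    exact LowPoint.conn_trans (hconn ω hωV) hv
  have hzero : (μH 1).real (InfCl z) = 0 := by
    rw [measureReal_def, measure_infCl_floor z hz0, ENNReal.toReal_zero]
  have hle : (μH 1).real V * (μH 1).real (InfCl a) ≤ 0 := by
    calc (μH 1).real V * (μH 1).real (InfCl a) ≤ (μH 1).real (V ∩ InfCl a) := hH
      _ ≤ (μH 1).real (InfCl z) := measureReal_mono hsub
      _ = 0 := hzero
  have hreal : (μH 1).real (InfCl a) = 0 :=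
    le_antisymm (nonpos_of_mul_nonpos_right (by linarith) hVpos |> fun h => by
      nlinarith [measureReal_nonneg (μ := μH 1) (s := InfCl a)]) measureReal_nonneg
  exact (measureReal_eq_zero_iff (measure_ne_top _ _)).1 hreal

/-- Almost surely, the `ℍ`-cluster of every point of `ℍ` is finite. -/
theorem ae_finite_clusterIn :
    ∀ᵐ ω ∂μH 1, ∀ a : Site 3, 0 ≤ a 0 → (clusterIn {x : Site 3 | 0 ≤ x 0} ω a).Finite := by
  rw [ae_all_iff]
  intro a
  by_cases ha : 0 ≤ a 0
  · have := measure_eq_zero_iff_ae_notMem.1 (measure_infCl a ha)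
    filter_upwards [this] with ω hω _ using Set.not_infinite.1 hω
  · exact Filter.Eventually.of_forall fun ω h => (ha h).elim

/-- **Registered sub-goal `stub_floorCouplingCluster`** (def-free form of `ae_finite_clusterIn`). -/
theorem stub_floorCouplingCluster :
    ∀ᵐ ω ∂floorDilutedPercolation 3 (criticalProbI 3) 1,
      ∀ a : Site 3, 0 ≤ a 0 → {v : Site 3 | ω ∈ openConnIn {x : Site 3 | 0 ≤ x 0} a v}.Finite :=
  ae_finite_clusterIn

end Finite

end Summit.CriticalPhenomena.PercolationContinuityZ3.Theorems.FloorRusso.Coupling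

end
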